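import Mathlib.Combinatorics.Matroid.Rank.ENat
import Mathlib.Combinatorics.Matroid.Sum
import Mathlib.Data.Fintype.List
import Mathlib.Data.Fintype.Pi
import Mathlib.Algebra.BigOperators.Fin
import Mathlib.Algebra.Field.Rat
import Mathlib.Data.Rat.Cast.Defs
import HarnessLib

/-!
# The Hepp bound of a matroid (Panzer 2022)

Topic `Combinatorics/Matroid` (definition request `defn-heppBound` of route
`KontsevichZagierPeriods/PhiFourLaboratory`). Source read: E. Panzer, *Hepp's bound for Feynman
graphs and matroids*, Ann. Inst. Henri Poincaré D **10** (2023) 31–119, doi:10.4171/aihpd/126 =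
arXiv:1908.09820 [Panzer2022] — §2.1 Def. 2.4 (the combinatorial definition as a sum over all
orderings of the edges), §2.3 (extension to matroids: "The surplus of edges is the corank
`ℓ(γ) := |E_γ| - rank γ` … and so (2.4) defines the Hepp bound for all matroids"), Def. 2.15
(connected matroid), Prop. 2.9 (agreement with the Mellin integral on the convergence cone),
§3.1 Def. 3.1 (bridges, bridgeless) and Prop. 3.2 (the flag formula over bridgeless flags) with
Ex. 3.3 (`H(K₄) = 84`) and the recursion displayed after Ex. 3.5 in §3.1 (the same formula in a
free dimension `D`, written `Hepp_D` there).

## Contents (namespace `Literature.Combinatorics.Matroid`)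

Generic layer (a finite "edge" set `E : Finset α` and a corank function `ℓ : Finset α → ℕ`):
* `orderings E` — the finset of lists enumerating `E` without repetition (the `N!` total orders
  `σ` of Def. 2.4; `Multiset.lists`).
* `sdcOfCorank ℓ D a γ = Σ_{e ∈ γ} a_e - (D/2)·ℓ(γ)` — the superficial degree of convergence
  `ω(γ)` (§2.1).
* `heppSumOfCorank ℓ E D a = Σ_σ Π_{k=1}^{N-1} ω(E^σ_k)⁻¹` — the sum of Def. 2.4, with the
  dimension `D` a free parameter (Panzer's `Hepp_D` of §3.1).
* `logDimOfCorank ℓ E a = 2 (Σ_e a_e) / ℓ(E)` — the dimension imposed by `ω(E) = 0`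
  ("logarithmic divergence", §2.1).
* `IsBridgelessOfCorank`, `bridgelessFlagsOfCorank`, `heppFlagSumOfCorank` — bridgeless subsets
  (Def. 3.1 in the form `ℓ(γ ∖ e) < ℓ(γ)` for all `e ∈ γ`), the flags
  `∅ = γ₀ ⊊ γ₁ ⊊ ⋯ ⊊ γ_ℓ = E` of bridgeless sets with `ℓ(γ_k) = k`, and the right-hand side of
  the flag formula of Prop. 3.2.

Matroid layer (`M : Matroid α`, `[M.Finite]`): `groundFinset`, `corank M γ = |γ| - rk γ`
(Panzer's `ℓ(γ)`, "loop number"), `sdc`, `heppBoundDim M D a` (`Hepp_D(M, a⃗)`),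
`logDim`, `heppBound M a` (Def. 2.4 proper: `D` determined by `ω(M) = 0`), `unitHeppBound M`
(unit indices `a_e = 1`: the rational number `H(M)` of eq. (1.5) and Ex. 2.13), `IsBridgeless`,
`bridgelessFlags`, `heppFlagSum`, `IsConnectedMatroid` (Def. 2.15, via Mathlib's
`Matroid.disjointSum`), and ONE named fact `Panzer2022_prop_3_2` (Def. 2.4 = flag formula,
pointwise wherever no denominator vanishes).

## Design

* Values are POINTWISE evaluations in a field `𝕜` of Panzer's rational functions of the indices
  `a⃗` and of `D`; where a denominator `ω(γ)` vanishes Lean's `x / 0 = 0` gives a junk summand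
  (this happens exactly on the polar hyperplanes of Lemma 2.28; for indices in the convergence
  cone `Λ` of Prop. 2.9 — e.g. unit indices on a primitive-divergent `φ⁴` graph — every `ω(γ) > 0`
  and nothing is junk).
* `heppSumOfCorank ℓ ∅ D a = 1` (one empty ordering, empty product): Def. 2.4 assumes `N ≥ 1`;
  the value at the empty matroid is a harmless junk value.
* Orders of `E` are lists (`Multiset.lists`), initial segments are `List.take`; this is literally
  Def. 2.4's `G^σ_k = {σ(1), …, σ(k)}`.
* Graphs (edge lists, the encoding of the route) are treated in
  `Literature/MathematicalPhysics/QuantumFieldTheory/HeppBound.lean` by feeding the graphic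
  corank `loopNumber` of `GraphPeriod.lean` to the generic layer; Mathlib at this pin has neither
  graphic nor vector matroids, nor matroid connectivity, and only the `ℕ∞`-valued rank `eRk`.

Deliberately NOT here: the Mellin-integral form (1.5)/(2.1) and Prop. 2.9, Thm 2.19 (vanishing iff
disconnected), the symmetries of §4 (duality Prop. 4.5, 2-sum Prop. 4.10, completion, twist,
Fourier split — Thm 1.1), the polytope volume Thm 1.3, wheels Prop. 3.19, `H(K₄) = 84` (Ex. 3.3;
the route's own calibration item `HeppK4`).

## References

* [Panzer2022] E. Panzer, *Hepp's bound for Feynman graphs and matroids*, AIHPD 10 (2023),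
  doi:10.4171/aihpd/126, arXiv:1908.09820 — §1 eq. (1.5), §2.1, Def. 2.4, §2.3, Ex. 2.13,
  Def. 2.15, Prop. 2.9, Def. 3.1, Prop. 3.2, Ex. 3.3, §3.1.
* J. Oxley, *Matroid Theory*, 2nd ed., OUP 2011, §4.1 (connectivity), for terminology.
-/

noncomputable section

open Finset

namespace Literature.Combinatorics.Matroid

/-! ### Generic layer: orderings, superficial degree of convergence, the Hepp sum -/

section Generic

variable {α : Type*} {𝕜 : Type*} [Field 𝕜]

/-- The total orderings of a finite set `E`: the lists without repetition whose underlying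
multiset is `E` (Def. 2.4's "permutations `σ` of its edges", `σ ↦ [σ(1), …, σ(N)]`). [cite: Panzer2022, Def. 2.4] -/
def orderings (E : Finset α) : Finset (List α) :=
  ⟨Multiset.lists E.val, Multiset.lists_nodup_finset E⟩

/-- A list is an ordering of `E` iff its underlying multiset is `E`. [folklore] -/
theorem mem_orderings_iff {E : Finset α} {l : List α} :
    l ∈ orderings E ↔ (l : Multiset α) = E.val := by
  change l ∈ Multiset.lists E.val ↔ _
  rw [Multiset.mem_lists_iff, Multiset.quot_mk_to_coe, eq_comm]

/-- The orderings of a singleton: only the one-element list. [folklore] -/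
@[simp] theorem orderings_singleton (e : α) : orderings ({e} : Finset α) = {[e]} := by
  ext l
  rw [mem_orderings_iff, Finset.mem_singleton, Finset.singleton_val, ← Multiset.coe_singleton,
    Multiset.coe_eq_coe, List.perm_singleton]

/-- The **superficial degree of convergence** of an edge set `γ` for indices `a⃗` in dimension
`D`, given a corank ("loop number") function `ℓ`:
`ω(γ) = Σ_{e ∈ γ} a_e - (D/2) · ℓ(γ)` (Panzer 2022, §2.1, the display defining `ω`). [cite: Panzer2022, §2.1 (definition of ω = sdc)] -/
def sdcOfCorank (ℓ : Finset α → ℕ) (D : 𝕜) (a : α → 𝕜) (γ : Finset α) : 𝕜 :=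
  (∑ e ∈ γ, a e) - D / 2 * (ℓ γ : 𝕜)

/-- Unfolding `sdcOfCorank` (definitional). [folklore] -/
theorem sdcOfCorank_apply (ℓ : Finset α → ℕ) (D : 𝕜) (a : α → 𝕜) (γ : Finset α) :
    sdcOfCorank ℓ D a γ = (∑ e ∈ γ, a e) - D / 2 * (ℓ γ : 𝕜) := rfl

/-- **Panzer's Hepp sum in dimension `D`** for a corank function `ℓ` on the edge set `E` with
`N = |E|` elements and indices `a⃗`:
`Hepp_D(E, a⃗) = Σ_σ 1 / (ω(E^σ_1) ⋯ ω(E^σ_{N-1}))`, the sum over all `N!` orderings `σ` of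
`E`, `E^σ_k = {σ(1), …, σ(k)}` the first `k` edges (Def. 2.4; the dimension is kept as a free
parameter as in the recursion for `Hepp_D` displayed after Ex. 3.5, §3.1). Pointwise evaluation: a vanishing
`ω(E^σ_k)` contributes the junk factor `0⁻¹ = 0`. [cite: Panzer2022, Def. 2.4] -/
def heppSumOfCorank [DecidableEq α] (ℓ : Finset α → ℕ) (E : Finset α) (D : 𝕜) (a : α → 𝕜) : 𝕜 :=
  ∑ l ∈ orderings E, ∏ k ∈ Finset.Ico 1 E.card, (sdcOfCorank ℓ D a (l.take k).toFinset)⁻¹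

/-- Unfolding `heppSumOfCorank` (definitional). [folklore] -/
theorem heppSumOfCorank_eq [DecidableEq α] (ℓ : Finset α → ℕ) (E : Finset α) (D : 𝕜) (a : α → 𝕜) :
    heppSumOfCorank ℓ E D a =
      ∑ l ∈ orderings E, ∏ k ∈ Finset.Ico 1 E.card,
        (sdcOfCorank ℓ D a (l.take k).toFinset)⁻¹ := rfl

/-- A single edge has Hepp sum `1` (the empty product; Def. 2.4: "For a single edge `N = 1`, the
empty product in the denominator is defined as unity such that `H(G, a₁) = 1`"). [cite: Panzer2022, Def. 2.4] -/
@[simp] theorem heppSumOfCorank_singleton [DecidableEq α] (ℓ : Finset α → ℕ) (e : α) (D : 𝕜) (a : α → 𝕜) :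
    heppSumOfCorank ℓ {e} D a = 1 := by
  simp [heppSumOfCorank]

/-- The **logarithmically divergent dimension** of `E` for indices `a⃗`: the value of `D` solving
`ω(E) = 0`, i.e. `D = 2 (a_1 + ⋯ + a_N) / ℓ(E)` (Panzer 2022, §2.1, the display after the
definition of `ω`); junk `0` when `ℓ(E) = 0` (forests, where the constraint is on `a⃗` instead,
ibid.). [cite: Panzer2022, §2.1 (logarithmic divergence)] -/
def logDimOfCorank (ℓ : Finset α → ℕ) (E : Finset α) (a : α → 𝕜) : 𝕜 :=
  2 * (∑ e ∈ E, a e) / (ℓ E : 𝕜)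

/-- An edge set `γ` is **bridgeless** (1PI; no bridges = coloops) for the corank function `ℓ`:
deleting any of its edges lowers the loop number, `ℓ(γ ∖ e) < ℓ(γ)` for all `e ∈ γ` (Panzer
2022, Def. 3.1 and the displayed equivalence "`M` is bridgeless ⇔ `ℓ(M ∖ e) < ℓ(M)` holds for
all `e`"). [cite: Panzer2022, Def. 3.1] -/
def IsBridgelessOfCorank [DecidableEq α] (ℓ : Finset α → ℕ) (γ : Finset α) : Prop :=
  ∀ e ∈ γ, ℓ (γ.erase e) < ℓ γ

/-- Bridgelessness of a finite set is decidable (a finite conjunction of `<` on `ℕ`). [folklore] -/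
instance IsBridgelessOfCorank.instDecidable [DecidableEq α] (ℓ : Finset α → ℕ) (γ : Finset α) :
    Decidable (IsBridgelessOfCorank ℓ γ) := by
  unfold IsBridgelessOfCorank; infer_instance

/-- The **flags of bridgeless sets** `∅ = γ₀ ⊊ γ₁ ⊊ ⋯ ⊊ γ_ℓ = E`, each `γ_k` bridgeless with
`ℓ(γ_k) = k`, where `ℓ = ℓ(E)` (Panzer 2022, Prop. 3.2, the set `Fl^{1PI}(M)`), encoded as
functions `γ : Fin (ℓ(E) + 1) → Finset α`. [cite: Panzer2022, Prop. 3.2] -/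
def bridgelessFlagsOfCorank [DecidableEq α] (ℓ : Finset α → ℕ) (E : Finset α) :
    Finset (Fin (ℓ E + 1) → Finset α) :=
  (Fintype.piFinset fun _ => E.powerset).filter fun γ =>
    γ 0 = ∅ ∧ γ (Fin.last (ℓ E)) = E ∧ (∀ i : Fin (ℓ E), γ i.castSucc ⊂ γ i.succ) ∧
      ∀ i : Fin (ℓ E + 1), IsBridgelessOfCorank ℓ (γ i) ∧ ℓ (γ i) = (i : ℕ)

/-- Membership in `bridgelessFlagsOfCorank` (definitional unfolding). [cite: Panzer2022, Prop. 3.2] -/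
theorem mem_bridgelessFlagsOfCorank_iff [DecidableEq α] (ℓ : Finset α → ℕ) (E : Finset α)
    (γ : Fin (ℓ E + 1) → Finset α) :
    γ ∈ bridgelessFlagsOfCorank ℓ E ↔
      (∀ i, γ i ⊆ E) ∧ γ 0 = ∅ ∧ γ (Fin.last (ℓ E)) = E ∧
        (∀ i : Fin (ℓ E), γ i.castSucc ⊂ γ i.succ) ∧
          ∀ i : Fin (ℓ E + 1), IsBridgelessOfCorank ℓ (γ i) ∧ ℓ (γ i) = (i : ℕ) := by
  simp only [bridgelessFlagsOfCorank, Finset.mem_filter, Fintype.mem_piFinset, Finset.mem_powerset]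

/-- **The bridgeless-flag sum** (right-hand side of Panzer's flag formula, Prop. 3.2, in a free
dimension `D` as in the recursion for `Hepp_D` of §3.1):
`(1/(a_1⋯a_N)) Σ_{γ_• ∈ Fl^{1PI}} (a_{γ₁/γ₀} ⋯ a_{γ_ℓ/γ_{ℓ-1}}) / (ω(γ₁) ⋯ ω(γ_{ℓ-1}))`, where
`a_{γ/δ} = Σ_{e ∈ γ ∖ δ} a_e`. With unit indices in `D = 4` this is
`Σ |γ₁|·|γ₂∖γ₁|⋯|E∖γ_{ℓ-1}| / Π_{k<ℓ} (|γ_k| - 2k)`, the formula inlined by the route items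
`TropicalLifting`/`HeppForward`/`HeppK4`. [cite: Panzer2022, Prop. 3.2] -/
def heppFlagSumOfCorank [DecidableEq α] (ℓ : Finset α → ℕ) (E : Finset α) (D : 𝕜) (a : α → 𝕜) : 𝕜 :=
  (∏ e ∈ E, a e)⁻¹ *
    ∑ γ ∈ bridgelessFlagsOfCorank ℓ E,
      (∏ i : Fin (ℓ E), ∑ e ∈ γ i.succ \ γ i.castSucc, a e) /
        ∏ i : Fin (ℓ E), if (i : ℕ) = 0 then 1 else sdcOfCorank ℓ D a (γ i.castSucc)

end Generic

/-! ### Matroid layer -/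

section MatroidLayer

variable {α : Type*} {𝕜 : Type*} [Field 𝕜]

/-- The ground set of a finite matroid as a `Finset`. [folklore] -/
def groundFinset (M : Matroid α) [M.Finite] : Finset α :=
  M.ground_finite.toFinset

/-- Membership in `groundFinset` is membership in the ground set. [folklore] -/
@[simp] theorem mem_groundFinset {M : Matroid α} [M.Finite] {e : α} :
    e ∈ groundFinset M ↔ e ∈ M.E :=
  Set.Finite.mem_toFinset _

/-- `groundFinset` coerces back to the ground set. [folklore] -/
@[simp] theorem coe_groundFinset (M : Matroid α) [M.Finite] :
    (groundFinset M : Set α) = M.E :=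
  Set.Finite.coe_toFinset _

/-- The **corank** ("loop number", "surplus of edges") of a finite edge set `γ` in the matroid
`M`: `ℓ(γ) = |γ| - rank γ` (Panzer 2022, §2.3; for the cycle matroid of a graph this is the
first Betti number, eq. (2.2)). Meant for `γ ⊆ M.E` (elements outside the ground set count as loops). [cite: Panzer2022, §2.3 (corank)] -/
def corank (M : Matroid α) (γ : Finset α) : ℕ :=
  γ.card - (M.eRk (γ : Set α)).toNat

/-- The rank of a finite set is finite and at most its cardinality. [folklore] -/
theorem eRk_toNat_le_card (M : Matroid α) (γ : Finset α) :
    (M.eRk (γ : Set α)).toNat ≤ γ.card := by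
  have h : M.eRk (γ : Set α) ≤ (γ.card : ℕ∞) := by
    simpa [Set.encard_coe_eq_coe_finsetCard] using M.eRk_le_encard (γ : Set α)
  have hfin : M.eRk (γ : Set α) ≠ ⊤ := ne_top_of_le_ne_top (ENat.coe_ne_top _) h
  exact_mod_cast (ENat.coe_toNat hfin).symm ▸ h

/-- `rank + corank = cardinality` for finite sets (definitional bookkeeping of `corank`). [cite: Panzer2022, §2.3 (corank)] -/
theorem eRk_toNat_add_corank (M : Matroid α) (γ : Finset α) :
    (M.eRk (γ : Set α)).toNat + corank M γ = γ.card := by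
  rw [corank, Nat.add_sub_cancel' (eRk_toNat_le_card M γ)]

/-- The empty set has corank `0`. [folklore] -/
@[simp] theorem corank_empty (M : Matroid α) : corank M ∅ = 0 := by
  simp [corank]

/-- The superficial degree of convergence `ω(γ) = Σ_{e∈γ} a_e - (D/2) ℓ(γ)` of an edge set of a
matroid (Panzer 2022, §2.1 with §2.3). [cite: Panzer2022, §2.1 and §2.3 (ω for matroids)] -/
def sdc (M : Matroid α) (D : 𝕜) (a : α → 𝕜) (γ : Finset α) : 𝕜 :=
  sdcOfCorank (corank M) D a γ

/-- Unfolding `sdc`. [folklore] -/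
theorem sdc_apply (M : Matroid α) (D : 𝕜) (a : α → 𝕜) (γ : Finset α) :
    sdc M D a γ = (∑ e ∈ γ, a e) - D / 2 * (corank M γ : 𝕜) := rfl

/-- **The Hepp bound of a finite matroid in dimension `D`**, `Hepp_D(M, a⃗)`: Def. 2.4's sum
`Σ_σ Π_{k=1}^{N-1} ω(M^σ_k)⁻¹` over all orderings `σ` of the ground set, with `ω` computed from
the corank of `M` (§2.3) and `D` a free parameter (`Hepp_D`, §3.1). [cite: Panzer2022, Def. 2.4 with §2.3] -/
def heppBoundDim [DecidableEq α] (M : Matroid α) [M.Finite] (D : 𝕜) (a : α → 𝕜) : 𝕜 :=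
  heppSumOfCorank (corank M) (groundFinset M) D a

/-- Unfolding `heppBoundDim` to Def. 2.4's sum over orderings. [cite: Panzer2022, Def. 2.4] -/
theorem heppBoundDim_eq [DecidableEq α] (M : Matroid α) [M.Finite] (D : 𝕜) (a : α → 𝕜) :
    heppBoundDim M D a =
      ∑ l ∈ orderings (groundFinset M), ∏ k ∈ Finset.Ico 1 (groundFinset M).card,
        (sdc M D a (l.take k).toFinset)⁻¹ := rfl

/-- The dimension `D = 2 (Σ_e a_e) / ℓ(M)` in which `M` is logarithmically divergent,
`ω(M) = 0` (Panzer 2022, §2.1); junk `0` for corank-`0` (free) matroids. [cite: Panzer2022, §2.1 (logarithmic divergence)] -/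
def logDim (M : Matroid α) [M.Finite] (a : α → 𝕜) : 𝕜 :=
  logDimOfCorank (corank M) (groundFinset M) a

/-- **The Hepp bound `H(M, a⃗)` of a finite matroid** (Panzer 2022, Def. 2.4 with §2.3): the
rational function of the indices obtained from `Hepp_D` by imposing logarithmic divergence
`ω(M) = 0`, i.e. `D = 2 (Σ a_e)/ℓ(M)`. By Prop. 2.9 it is the Mellin integral (1.5) of
`(Ψ^trop_M)^{-D/2}` whenever `a⃗` lies in the convergence cone. [cite: Panzer2022, Def. 2.4] -/
def heppBound [DecidableEq α] (M : Matroid α) [M.Finite] (a : α → 𝕜) : 𝕜 :=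
  heppBoundDim M (logDim M a) a

/-- Unfolding `heppBound`: `Hepp_D` at the logarithmically divergent dimension (definitional). [cite: Panzer2022, Def. 2.4] -/
theorem heppBound_eq [DecidableEq α] (M : Matroid α) [M.Finite] (a : α → 𝕜) :
    heppBound M a = heppBoundDim M (logDim M a) a := rfl

/-- **The Hepp bound `H(M) ∈ ℚ`** at unit indices `a_e = 1` (Panzer 2022, eq. (1.5) and §2.3,
e.g. `H(U_{n,r}) = n!/((r-1)! ℓ!) (ℓ/r)^ℓ` (Ex. 2.13), `H(K₄) = 84` (Ex. 3.3)); then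
`D/2 = N/ℓ(M)`. [cite: Panzer2022, Def. 2.4 and eq. (1.5)] -/
def unitHeppBound [DecidableEq α] (M : Matroid α) [M.Finite] : ℚ :=
  heppBound M fun _ => (1 : ℚ)

/-- Unfolding `unitHeppBound` (definitional). [cite: Panzer2022, Def. 2.4 and eq. (1.5)] -/
theorem unitHeppBound_eq [DecidableEq α] (M : Matroid α) [M.Finite] :
    unitHeppBound M = heppBoundDim M (logDim M fun _ => (1 : ℚ)) fun _ => 1 := rfl

/-- A finite edge set `γ` of `M` is **bridgeless** (Def. 3.1: no bridges = coloops of `M|γ`;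
equivalently `ℓ(γ ∖ e) < ℓ(γ)` for every `e ∈ γ`). [cite: Panzer2022, Def. 3.1] -/
def IsBridgeless [DecidableEq α] (M : Matroid α) (γ : Finset α) : Prop :=
  IsBridgelessOfCorank (corank M) γ

/-- Unfolding `IsBridgeless`: every deletion lowers the corank. [cite: Panzer2022, Def. 3.1] -/
theorem isBridgeless_iff [DecidableEq α] (M : Matroid α) (γ : Finset α) :
    IsBridgeless M γ ↔ ∀ e ∈ γ, corank M (γ.erase e) < corank M γ := Iff.rfl

/-- The bridgeless flags `∅ = γ₀ ⊊ ⋯ ⊊ γ_ℓ = E(M)` of `M` with `ℓ(γ_k) = k`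
(Prop. 3.2, `Fl^{1PI}(M)`). [cite: Panzer2022, Prop. 3.2] -/
def bridgelessFlags [DecidableEq α] (M : Matroid α) [M.Finite] :
    Finset (Fin (corank M (groundFinset M) + 1) → Finset α) :=
  bridgelessFlagsOfCorank (corank M) (groundFinset M)

/-- The **bridgeless-flag sum** of `M` in dimension `D` (right-hand side of Prop. 3.2). [cite: Panzer2022, Prop. 3.2] -/
def heppFlagSum [DecidableEq α] (M : Matroid α) [M.Finite] (D : 𝕜) (a : α → 𝕜) : 𝕜 :=
  heppFlagSumOfCorank (corank M) (groundFinset M) D a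

/-- A matroid is **connected** if it is not the direct sum of two non-empty proper submatroids
(Panzer 2022, Def. 2.15; Oxley §4.1): no non-empty proper `X ⊊ E` splits `M` as
`M|X ⊕ M|(E ∖ X)` (Mathlib's `Matroid.disjointSum`). [cite: Panzer2022, Def. 2.15] -/
def IsConnectedMatroid (M : Matroid α) : Prop :=
  ∀ X : Set α, X ⊆ M.E → X.Nonempty → X ≠ M.E →
    M ≠ (M.restrict X).disjointSum (M.restrict (M.E \ X)) Set.disjoint_sdiff_right

/-- **Panzer's flag formula** (named fact; Panzer 2022, Prop. 3.2, with the free-dimension form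
`Hepp_D` of the recursion displayed after Ex. 3.5): for a connected finite matroid `M` with
`ℓ(M) ≥ 1` loops, the Hepp bound of Def. 2.4
equals the sum over flags of bridgeless submatroids,
`H(M, a⃗) = (1/(a_1⋯a_N)) Σ_{γ_•} a_{γ₁/γ₀}⋯a_{γ_ℓ/γ_{ℓ-1}} / (ω(γ₁)⋯ω(γ_{ℓ-1}))`.
The source proves it as an identity of rational functions in the indices (and `D`); stated here
pointwise at every point of a field of characteristic `0` where none of the denominators
occurring on either side vanishes (`ω(γ) ≠ 0` for all `∅ ≠ γ ⊊ E`, and `a_e ≠ 0`), which the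
identity of rational functions implies (types in `Type`, the universe of `Fin n`, `ℚ`, `ℝ`, `ℂ`). [cite: Panzer2022, Prop. 3.2] -/
def Panzer2022_prop_3_2 : Prop :=
  ∀ {α : Type} [DecidableEq α] {𝕜 : Type} [Field 𝕜] [CharZero 𝕜] (M : Matroid α) [M.Finite],
    IsConnectedMatroid M → 1 ≤ corank M (groundFinset M) →
      ∀ (D : 𝕜) (a : α → 𝕜),
        (∀ γ : Finset α, γ ⊆ groundFinset M → γ.Nonempty → γ ≠ groundFinset M →
            sdc M D a γ ≠ 0) →
          (∀ e ∈ groundFinset M, a e ≠ 0) →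
            heppBoundDim M D a = heppFlagSum M D a

end MatroidLayer

end Literature.Combinatorics.Matroid
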